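import Literature.RepresentationTheory.BorelWallach2000.TrivialModuleGKCohomology
import HarnessLib

/-!
# `(𝔤, K)`-cohomology of a compact factor vanishes in positive degrees (`𝔤 = 𝔨`)

Topic `RepresentationTheory/BorelWallach2000`; theorems only (no definition, no named fact, no `sorry`).
Cell `hodgecm-mathlib`, T4 (ROG-SPEC S2, row R0-a of B-plan2's census key `KEY-…-t4-kc-outright-census`):
the degree-one `(𝔤, K)`-census for `U(2,1) × U(3)^N` needs, for the COMPACT factors, that a connected
compact group contributes no `(𝔤, K)`-cohomology in positive degrees: if `𝔤 = 𝔨` then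
`C^q(𝔤, K; V) = Hom_K(Λ^q(𝔤/𝔨), V) = 0` for `q > 0`, hence `H^q(𝔤, K; V) = 0`, for EVERY `(𝔤, K)`-module `V`
(A. Borel, N. Wallach, *Continuous cohomology, discrete subgroups, and representations of reductive
groups*, 2nd ed. (2000), I §1.2 (1) with `m = dim 𝔤/𝔨 = 0`, I §5.1; II 1.4 (1) with `𝔭 = 0`).  This is the
case `W = 0` of the tree's `subsingleton_gkCohomology_of_finrank_lt` (`TrivialModuleGKCohomology.lean`,
«`𝔤 = 𝔨 + T(W)`, `q > dim W`»), recorded here BY NAME in the two currencies consumers use: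

* `RealMatrixGroup.kInLie_eq_top_of_forall_star_eq_neg` — if every element of `𝔤 ≤ Matrix N N A` is
  skew-hermitian (`star X = -X`; the definite unitary groups `U(J)`, `J` positive definite, after the usual
  conjugation, and every closed subgroup of `U(N, A)`), then `𝔨 = 𝔤 ∩ 𝔲(N, A)` is all of `𝔤` (`G.kInLie = ⊤`);
* `subsingleton_gkCohomology_of_kInLie_eq_top` / `finrank_gkCohomology_of_kInLie_eq_top` — `𝔨 = 𝔤`
  ⇒ `H^q(𝔤, K; V)` is a subsingleton / has `finrank = 0` over any nontrivial scalar ring, for `q > 0`;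
* `subsingleton_gkCohomology_of_forall_star_eq_neg` / `finrank_gkCohomology_of_forall_star_eq_neg` — the
  composite in matrix currency.

The Künneth rule that removes such factors from a product is the tree's `ProductsAndAdelicPieces.lean`
(Borel–Wallach I 1.3 / II 9.2).  HC_CM is proved only modulo the printed citations until rung 0 of the
ladder closes; nothing about `U(2,1)` is asserted here.

## References
* [BorelWallach2000] A. Borel, N. Wallach, *Continuous cohomology, discrete subgroups, and representations
  of reductive groups*, 2nd ed., AMS (2000), I §1.2 (1), I §1.4, I §5.1 (1)–(4), II §1.4 (1).
* [Knapp2002] A. W. Knapp, *Lie Groups Beyond an Introduction*, 2nd ed., VI §2 (`𝔨 = 𝔤 ∩ 𝔲(N)`).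
-/

set_option autoImplicit false

noncomputable section

open scoped Matrix MatrixGroups

namespace Literature.RepresentationTheory.BorelWallach2000

open Literature.Algebra.Lie Literature.Algebra.Lie.ChevalleyEilenberg
open Literature.NumberTheory.Automorphic Literature.NumberTheory.Automorphic.GKTrivialTensor

-- Mathlib idiom (as in `GKCohomology.lean` / `TrivialModuleGKCohomology.lean`, whose `gkCohomology G ρK ρ𝔤 hV`
-- this file instantiates): the commutator bracket on the associative algebra `Module.End ℂ V`.
attribute [local instance 100] LieRing.ofAssociativeRing

variable {A : Type*} [NormedCommRing A] [NormedAlgebra ℝ A] [NormedAlgebra ℚ A] [CompleteSpace A]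
  [StarRing A] [StarModule ℝ A] {N : Type*} [Fintype N] [DecidableEq N] (G : RealMatrixGroup A N)

/-- **`𝔨 = 𝔤` for a group of unitary matrices**: if every `X ∈ 𝔤` is skew-hermitian then
`𝔨 = 𝔤 ∩ 𝔲(N, A) = 𝔤`, i.e. `G.kInLie = ⊤` (Knapp VI §2, (6.24): `𝔨 = 𝔤 ∩ 𝔲(N)`; for `G ≤ U(N)` this is all of
`𝔤`). [cite: Knapp2002, VI §2 (6.24)] [cite: BorelWallach2000, II §1.4 (1)] -/
theorem _root_.Literature.NumberTheory.Automorphic.RealMatrixGroup.kInLie_eq_top_of_forall_star_eq_neg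
    (hG : ∀ X : G.lie, star (X : Matrix N N A) = -(X : Matrix N N A)) : G.kInLie = ⊤ := by
  rw [eq_top_iff]
  intro X _
  rw [RealMatrixGroup.mem_kInLie_iff, RealMatrixGroup.mem_compactLie_iff]
  exact ⟨X.2, hG X⟩

variable {V : Type*} [AddCommGroup V] [Module ℂ V]
  (ρK : Representation ℂ G.maximalCompact V) (ρ𝔤 : G.lie →ₗ⁅ℝ⁆ Module.End ℂ V)
  (hV : ∀ (k : G.maximalCompact) (X : G.lie),
    ρK k ∘ₗ ρ𝔤 X ∘ₗ ρK k⁻¹ = ρ𝔤 (G.Ad (Subgroup.inclusion G.maximalCompact_le_carrier k) X))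

/-- **`H^q(𝔤, K; V) = 0` for `q > 0` when `𝔨 = 𝔤`** (Borel–Wallach I §1.2 (1) with `m = dim 𝔤/𝔨 = 0`;
II §1.4 (1), `𝔭 = 0`): for every `(𝔤, K)`-module `V` of a real matrix group with `G.kInLie = ⊤`, the
`(𝔤, K)`-cohomology in every positive degree is a subsingleton — the case `W = 0`, `T = 0` of
`subsingleton_gkCohomology_of_finrank_lt`. [cite: BorelWallach2000, I §1.2 (1) and I §5.1 (4)] -/
theorem subsingleton_gkCohomology_of_kInLie_eq_top (hk : G.kInLie = ⊤) {q : ℕ} (hq : 0 < q) :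
    Subsingleton (gkCohomology G ρK ρ𝔤 hV q) :=
  subsingleton_gkCohomology_of_finrank_lt G ρK ρ𝔤 hV (W := Fin 0 → ℝ) 0
    (fun X => ⟨0, by rw [map_zero, sub_zero, hk]; exact LieSubalgebra.mem_top X⟩)
    (by rw [Module.finrank_fin_fun]; exact hq)

/-- `dim_S H^q(𝔤, K; V) = 0` for `q > 0` when `𝔨 = 𝔤`, over any nontrivial ring of scalars `S` acting on
the cohomology. [cite: BorelWallach2000, I §1.2 (1) and I §5.1 (4)] -/
theorem finrank_gkCohomology_of_kInLie_eq_top (hk : G.kInLie = ⊤) {q : ℕ} (hq : 0 < q)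
    (S : Type*) [Ring S] [Nontrivial S] [Module S (gkCohomology G ρK ρ𝔤 hV q)] :
    Module.finrank S (gkCohomology G ρK ρ𝔤 hV q) = 0 :=
  haveI := subsingleton_gkCohomology_of_kInLie_eq_top G ρK ρ𝔤 hV hk hq
  Module.finrank_zero_of_subsingleton

/-- **Compact factor, matrix currency**: if every `X ∈ 𝔤` is skew-hermitian then `H^q(𝔤, K; V)` is a
subsingleton for every `(𝔤, K)`-module `V` and every `q > 0`. [cite: BorelWallach2000, II §1.4 (1) (`𝔭 = 0`)] -/
theorem subsingleton_gkCohomology_of_forall_star_eq_neg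
    (hG : ∀ X : G.lie, star (X : Matrix N N A) = -(X : Matrix N N A)) {q : ℕ} (hq : 0 < q) :
    Subsingleton (gkCohomology G ρK ρ𝔤 hV q) :=
  subsingleton_gkCohomology_of_kInLie_eq_top G ρK ρ𝔤 hV
    (RealMatrixGroup.kInLie_eq_top_of_forall_star_eq_neg G hG) hq

/-- `dim_S H^q(𝔤, K; V) = 0`, `q > 0`, in the same matrix currency. [cite: BorelWallach2000, II §1.4 (1) (`𝔭 = 0`)] -/
theorem finrank_gkCohomology_of_forall_star_eq_neg
    (hG : ∀ X : G.lie, star (X : Matrix N N A) = -(X : Matrix N N A)) {q : ℕ} (hq : 0 < q)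
    (S : Type*) [Ring S] [Nontrivial S] [Module S (gkCohomology G ρK ρ𝔤 hV q)] :
    Module.finrank S (gkCohomology G ρK ρ𝔤 hV q) = 0 :=
  finrank_gkCohomology_of_kInLie_eq_top G ρK ρ𝔤 hV
    (RealMatrixGroup.kInLie_eq_top_of_forall_star_eq_neg G hG) hq S

end Literature.RepresentationTheory.BorelWallach2000

end
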